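/-
Copyright (c) 2026 the pub-hodgecm-mathlib formalisation cell (harness21).  Prover seat hodgecm-mathlib-K2E1-p12 (g0), Track B ∕ K2-LIT, h413 = `stmt-HodgeConjecture-24833`,
line `K2_E1_TraceFormulaBeta`, campaign «R8₂-sph EXHAUSTION», ROADCARD row T4 (dealer K2E1-plan (g6) deals (104)∕(122)∕(124)) FILE T4b: the contour shift of the inner
product formula for spherical pseudo-Eisenstein series of `U(1,1)_{L∕L⁺}` from `Re z = σ₀ > 1` to the unitary axis `Re z = ½`, hypothesis-first on the continued scalar.
-/
import Summits.HodgeConjecture.HodgeConjecture.Theorems.K2E1VerticalLineContourShift     -- ★ T4a (this seat): contour shift between vertical lines across a simple pole at `z = 1`, Mathlib-only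
import Summits.HodgeConjecture.HodgeConjecture.Theorems.K2E1MellinPaleyWienerHalfLine       -- ★ A p859444 (K2E3-p12): `mellin` of `C²_c((0,∞))` data — entire, `O(y⁻²)` on vertical lines, `norm_mellin_le`
import Mathlib.Analysis.Calculus.Deriv.Star                                                -- Mathlib: `differentiableAt_conj_conj_iff` (Schwarz-reflection holomorphy of `z ↦ conj (g (conj z))`)
import HarnessLib

/-!
# T4b — `K2E1PseudoEisensteinContourShiftCMTwo`: the inner-product integrand of ★ FILE D moved from `Re z = σ₀` to `Re z = ½`, picking up the residue at `z = 1`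

Track B ∕ K2-LIT, crux h413 = `stmt-HodgeConjecture-24833`, route of record `HCCMUnconditional`; cell `hodgecm-mathlib`, squad K2, ENGINE E1.  THEOREMS ONLY (no `def`, no `instance`,
no `notation`, no `sorry`; default heartbeats); lane `--supports stmt-HodgeConjecture-24833 --as helper` (count-neutral).

THE MATHEMATICS ([MoeglinWaldspurger1995, II.2.1–II.2.4, IV.1.11]; [Titchmarsh1939, §3.12]; [Titchmarsh1948, Thm 71–72]).  ★ FILE D (`K2E1PseudoEisensteinInnerProductCMTwo[Final]`)
writes the inner product of two spherical pseudo-Eisenstein series of `U(1,1)_{L∕L⁺}` as `⟪θ_f, θ_{f′}⟫ = C·(2π)⁻¹ ∫_ℝ F(σ₀+iy) dy`, `σ₀ > 1`, with the INTEGRAND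
`F(z) = f̃(z)·(conj f̃′(1−z̄) + a·c(z)·conj f̃′(z̄))`, `f̃(z) = mellin f (−z)`, `a = (ν𝓕)⁻¹`, `c` the standard intertwining scalar.  The three Mellin factors are ENTIRE (★ A
`differentiable_mellin`; the two conjugated ones by Schwarz reflection, Mathlib `differentiableAt_conj_conj_iff`), `f̃` is `O(y⁻²)` on vertical lines UNIFORMLY for `Re z` in a compact
interval (§1, from ★ A `norm_mellin_vertical_le_div_sq` and `t^u ≤ t^{u₁} + t^{u₂}`), the conjugated factors are bounded on strips (§1, ★ A `norm_mellin_le`).  ON LETTERS for the scalar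
— `c` holomorphic on an open neighbourhood `U` of the closed strip `{½ ≤ Re z ≤ σ₀}` except at `z = 1`, `(z−1)c(z) → r` there (★ W5-B `sphericalConstantTerm_continuation` gives this on
the OPEN half-plane `Re z > ½`; the neighbourhood of the unitary axis is the functional-equation input, kept as a letter), and the T1 bound `‖c z‖ ≤ B` on `½ < Re z ≤ σ₀, |Im z| ≥ 1`
(★ p859417 `norm_intertwiningScalar_le_of_maassSelberg`, its exact bytes; extended to `Re z = ½` by continuity in §2) — the integrand `F` satisfies every hypothesis of ★ T4a
`integral_vertical_eq_integral_vertical_add_residue` with `σ₁ = ½`, `σ₂ = σ₀`, residue `ρ = a·r·f̃(1)·conj f̃′(1)` (§3: `(z−1)F(z) → f̃(1)·(0 + a·r·conj f̃′(1))`).  HENCE (§4 HEAD)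
**`pseudoEisenstein_contourShift_of_letters`**: from `hIP : IP = C·((2π)⁻¹∫_ℝ F(σ₀+iy) dy)` (★ FILE D's head),
`IP = C·(a·r·f̃(1)·conj f̃′(1)) + C·((2π)⁻¹ ∫_ℝ F(½+iy) dy)`, and `y ↦ F(½+iy) ∈ L¹(ℝ)` explicitly (§3 `integrable_innerProductIntegrand_vertical`) — ROADCARD T4
«`⟨θ_Φ,θ_Ψ⟩ = r·vol·φ̂(1)·conj ψ̂(1) + (1∕2π)∫_ℝ F(½+it) dt`, `F ∈ L¹` explicit» (the volume normalisations live in `C` and `a`).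
* §1 uniform Mellin bounds on strips (generic `ℝ → ℂ` data).  * §2 the scalar: closure of the T1 bound, continuity on the two lines.  * §3 the integrand: holomorphy off `1`, residue,
  uniform `O(y⁻²)`, integrability on every line of the closed strip.  * §4 HEAD.
HONEST LABEL: HC_CM is proved only modulo the 7 printed citations (2 remaining named inputs: hLiu418 = `stmt-HodgeConjecture-24832`, h413 = `stmt-HodgeConjecture-24833`) until rung 0
closes; this file asserts no named fact, closes no socket; count-neutral; letters: `hc`∕`hr` (continuation of `c` to a neighbourhood of the closed strip), `hB` (T1 ★ bytes), `hIP` (★ D head).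

## References
* [MoeglinWaldspurger1995] C. Mœglin, J.-L. Waldspurger, *Spectral decomposition and Eisenstein series* (1995), II.2.1–II.2.4, IV.1.11.
* [Titchmarsh1939] E. C. Titchmarsh, *The Theory of Functions* (2nd ed., 1939), §3.12.
* [Titchmarsh1948] E. C. Titchmarsh, *Introduction to the Theory of Fourier Integrals* (1948), §1.29, Thm 71–72.
-/

set_option autoImplicit false
set_option linter.dupNamespace false  -- the mandated namespace repeats the summit's segment (`HodgeConjecture.HodgeConjecture`)

noncomputable section

open MeasureTheory Measure Set Filter Topology Complex
open scoped Real ComplexConjugate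
open Summit.HodgeConjecture.HodgeConjecture.Cruxes.H413.K2E1MellinPaleyWienerHalfLine
open Summit.HodgeConjecture.HodgeConjecture.Cruxes.H413.K2E1VerticalLineContourShift

namespace Summit.HodgeConjecture.HodgeConjecture.Cruxes.H413.K2E1PseudoEisensteinContourShiftCMTwo

/-! ## §1 Uniform Mellin bounds on strips for `C_c((0,∞))` ∕ `C²_c((0,∞))` data -/

section Mellin

variable {g : ℝ → ℂ}

/-- `t ↦ t^u·‖g t‖` is integrable on `(0,∞)` for `g` continuous with compact support in `(0,∞)` (★ A `mellinConvergent_of_tsupport_subset_Ioi` at `u+1`, norms). [cite: Titchmarsh1948, §1.29] -/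
theorem integrableOn_rpow_mul_norm (hgc : Continuous g) (hgs : HasCompactSupport g) (hg0 : tsupport g ⊆ Ioi 0) (u : ℝ) :
    IntegrableOn (fun t : ℝ => t ^ u * ‖g t‖) (Ioi 0) := by
  have h : IntegrableOn (fun t : ℝ => ‖(t : ℂ) ^ (((u : ℂ) + 1) - 1) • g t‖) (Ioi 0) := (mellinConvergent_of_tsupport_subset_Ioi hgc hgs hg0 ((u : ℂ) + 1)).norm
  refine h.congr_fun (fun t ht => ?_) measurableSet_Ioi
  have ht' : (0 : ℝ) < t := ht
  dsimp only
  rw [norm_smul, add_sub_cancel_right, norm_cpow_eq_rpow_re_of_pos ht', ofReal_re]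

/-- `t^u ≤ t^{u₁} + t^{u₂}` for `t > 0` and `u₁ ≤ u ≤ u₂`. [folklore] -/
theorem rpow_le_rpow_add_rpow {t u u₁ u₂ : ℝ} (ht : 0 < t) (h₁ : u₁ ≤ u) (h₂ : u ≤ u₂) : t ^ u ≤ t ^ u₁ + t ^ u₂ := by
  by_cases h1 : 1 ≤ t
  · exact (Real.rpow_le_rpow_of_exponent_le h1 h₂).trans (le_add_of_nonneg_left (Real.rpow_nonneg ht.le _))
  · exact (Real.rpow_le_rpow_of_exponent_ge ht (not_le.1 h1).le h₁).trans (le_add_of_nonneg_right (Real.rpow_nonneg ht.le _))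

/-- `∫_0^∞ t^u‖g‖ ≤ ∫_0^∞ t^{u₁}‖g‖ + ∫_0^∞ t^{u₂}‖g‖` for `u₁ ≤ u ≤ u₂`. [folklore] -/
theorem setIntegral_rpow_mul_norm_le_add (hgc : Continuous g) (hgs : HasCompactSupport g) (hg0 : tsupport g ⊆ Ioi 0) {u u₁ u₂ : ℝ} (h₁ : u₁ ≤ u) (h₂ : u ≤ u₂) :
    ∫ t in Ioi (0 : ℝ), t ^ u * ‖g t‖ ≤ (∫ t in Ioi (0 : ℝ), t ^ u₁ * ‖g t‖) + ∫ t in Ioi (0 : ℝ), t ^ u₂ * ‖g t‖ := by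
  rw [← integral_add (integrableOn_rpow_mul_norm hgc hgs hg0 u₁) (integrableOn_rpow_mul_norm hgc hgs hg0 u₂)]
  refine setIntegral_mono_on (integrableOn_rpow_mul_norm hgc hgs hg0 u) ((integrableOn_rpow_mul_norm hgc hgs hg0 u₁).add (integrableOn_rpow_mul_norm hgc hgs hg0 u₂))
    measurableSet_Ioi fun t ht => ?_
  rw [← add_mul]
  exact mul_le_mul_of_nonneg_right (rpow_le_rpow_add_rpow ht h₁ h₂) (norm_nonneg _)

/-- **`mellin g` IS BOUNDED ON VERTICAL STRIPS**: `∃ B ≥ 0, ‖mellin g w‖ ≤ B` for `u₁ ≤ Re w ≤ u₂` (★ A `norm_mellin_le` made uniform). [cite: Titchmarsh1948, §1.29] -/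
theorem exists_norm_mellin_le_of_re_mem_Icc (hgc : Continuous g) (hgs : HasCompactSupport g) (hg0 : tsupport g ⊆ Ioi 0) (u₁ u₂ : ℝ) :
    ∃ B : ℝ, 0 ≤ B ∧ ∀ w : ℂ, u₁ ≤ w.re → w.re ≤ u₂ → ‖mellin g w‖ ≤ B := by
  refine ⟨(∫ t in Ioi (0 : ℝ), t ^ (u₁ - 1) * ‖g t‖) + ∫ t in Ioi (0 : ℝ), t ^ (u₂ - 1) * ‖g t‖,
    add_nonneg (setIntegral_nonneg measurableSet_Ioi fun t ht => mul_nonneg (Real.rpow_nonneg (le_of_lt ht) _) (norm_nonneg _))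
      (setIntegral_nonneg measurableSet_Ioi fun t ht => mul_nonneg (Real.rpow_nonneg (le_of_lt ht) _) (norm_nonneg _)), fun w hw₁ hw₂ => ?_⟩
  exact (norm_mellin_le g w).trans (setIntegral_rpow_mul_norm_le_add hgc hgs hg0 (by linarith) (by linarith))

/-- **UNIFORM `O(y⁻²)` ON STRIPS**: for `f ∈ C²_c((0,∞))`, `∃ B ≥ 0, ‖mellin f (σ+iy)‖ ≤ B∕y²` for all `σ ∈ [σ₁,σ₂]`, `y ≠ 0` (★ A `norm_mellin_vertical_le_div_sq` made uniform).
[cite: Titchmarsh1948, §1.29] -/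
theorem exists_norm_mellin_vertical_le_div_sq_of_mem_Icc {f : ℝ → ℂ} (hf : ContDiff ℝ 2 f) (hfs : HasCompactSupport f) (hf0 : tsupport f ⊆ Ioi 0) (σ₁ σ₂ : ℝ) :
    ∃ B : ℝ, 0 ≤ B ∧ ∀ σ ∈ Icc σ₁ σ₂, ∀ y : ℝ, y ≠ 0 → ‖mellin f ((σ : ℂ) + y * I)‖ ≤ B / y ^ 2 := by
  have h2 : ContDiff ℝ ((1 : WithTop ℕ∞) + 1) f := by rw [one_add_one_eq_two]; exact hf
  have hf1 : ContDiff ℝ 1 f := hf.of_le (by norm_num)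
  obtain ⟨-, hds, hd0⟩ := deriv_data hf1 hfs hf0
  obtain ⟨h2c, h2s, h20⟩ := deriv_data h2.deriv' hds hd0
  refine ⟨(∫ t in Ioi (0 : ℝ), t ^ (σ₁ + 1) * ‖deriv (deriv f) t‖) + ∫ t in Ioi (0 : ℝ), t ^ (σ₂ + 1) * ‖deriv (deriv f) t‖,
    add_nonneg (setIntegral_nonneg measurableSet_Ioi fun t ht => mul_nonneg (Real.rpow_nonneg (le_of_lt ht) _) (norm_nonneg _))
      (setIntegral_nonneg measurableSet_Ioi fun t ht => mul_nonneg (Real.rpow_nonneg (le_of_lt ht) _) (norm_nonneg _)), fun σ hσ' y hy => ?_⟩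
  refine (norm_mellin_vertical_le_div_sq hf hfs hf0 σ hy).trans (div_le_div_of_nonneg_right ?_ (by positivity))
  exact setIntegral_rpow_mul_norm_le_add h2c h2s h20 (by linarith [hσ'.1]) (by linarith [hσ'.2])

/-- `z ↦ conj (mellin g (−(1 − conj z)))` and `z ↦ conj (mellin g (−conj z))` are entire (Schwarz reflection of ★ A `differentiable_mellin`). [cite: Titchmarsh1939, §4.5] -/
theorem differentiable_conj_mellin_reflect (hgc : Continuous g) (hgs : HasCompactSupport g) (hg0 : tsupport g ⊆ Ioi 0) :
    Differentiable ℂ (fun z : ℂ => conj (mellin g (-(1 - conj z)))) ∧ Differentiable ℂ (fun z : ℂ => conj (mellin g (-conj z))) := by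
  have hd := differentiable_mellin hgc hgs hg0
  refine ⟨fun z => ?_, fun z => ?_⟩
  · have h : DifferentiableAt ℂ (conj ∘ (fun w : ℂ => mellin g (-(1 - w))) ∘ conj) z :=
      differentiableAt_conj_conj_iff.2 ((hd.comp (differentiable_const _ |>.sub differentiable_id).neg).differentiableAt)
    exact h
  · have h : DifferentiableAt ℂ (conj ∘ (fun w : ℂ => mellin g (-w)) ∘ conj) z := differentiableAt_conj_conj_iff.2 ((hd.comp differentiable_neg).differentiableAt)
    exact h

end Mellin

/-! ## §2 The scalar on the closed strip: closure of the T1 bound at `Re z = ½`, continuity on vertical lines -/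

section Scalar

variable {c : ℂ → ℂ} {U : Set ℂ} {σ₀ B : ℝ}

/-- **THE T1 BOUND EXTENDS TO THE UNITARY AXIS**: if `c` is continuous on `U ∖ {1}` (`U` open ⊇ the closed strip) and `‖c z‖ ≤ B` on `½ < Re z ≤ σ₀, |Im z| ≥ 1` (★ p859417's bytes), then
`‖c z‖ ≤ B` on `½ ≤ Re z ≤ σ₀, |Im z| ≥ 1` (`c(½+it) = lim_{x↓0} c(½+x+it)`). [cite: MoeglinWaldspurger1995, IV.1.11] -/
theorem norm_le_of_re_mem_Icc (hUo : IsOpen U) (hUs : {z : ℂ | 1 / 2 ≤ z.re ∧ z.re ≤ σ₀} ⊆ U) (hc : DifferentiableOn ℂ c (U \ {1})) (hσ₀ : 1 < σ₀)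
    (hB : ∀ z : ℂ, 1 / 2 < z.re → z.re ≤ σ₀ → 1 ≤ |z.im| → ‖c z‖ ≤ B) :
    ∀ z : ℂ, 1 / 2 ≤ z.re → z.re ≤ σ₀ → 1 ≤ |z.im| → ‖c z‖ ≤ B := by
  intro z hz₁ hz₂ hzi
  rcases lt_or_eq_of_le hz₁ with h | h
  · exact hB z h hz₂ hzi
  · -- `Re z = ½`: approach from the right
    have hz1 : z ≠ 1 := fun h' => by rw [h', one_re] at h; norm_num at h
    have hzU : z ∈ U \ {1} := ⟨hUs ⟨hz₁, hz₂⟩, hz1⟩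
    have hcont : ContinuousAt c z := (hc.differentiableAt ((hUo.sdiff isClosed_singleton).mem_nhds hzU)).continuousAt
    have hlim : Tendsto (fun x : ℝ => ‖c (z + x)‖) (𝓝[>] 0) (𝓝 ‖c z‖) := by
      have h1 : Tendsto (fun x : ℝ => z + (x : ℂ)) (𝓝 0) (𝓝 z) := by
        have h2 : Continuous fun x : ℝ => z + (x : ℂ) := continuous_const.add continuous_ofReal
        have h3 := h2.tendsto 0
        simpa using h3
      exact ((hcont.tendsto.comp h1).norm).mono_left nhdsWithin_le_nhds
    refine le_of_tendsto hlim ?_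
    filter_upwards [Ioo_mem_nhdsGT (show (0 : ℝ) < σ₀ - 1 / 2 by linarith)] with x hx
    refine hB _ ?_ ?_ ?_
    · simp only [add_re, ofReal_re]; linarith [hx.1]
    · simp only [add_re, ofReal_re]; linarith [hx.2]
    · simpa only [add_im, ofReal_im, add_zero] using hzi

/-- `y ↦ c(σ+iy)` is continuous for `σ ∈ [½, σ₀]`, `σ ≠ 1` (the line lies in `U ∖ {1}`). [folklore] -/
theorem continuous_scalar_vertical (hUs : {z : ℂ | 1 / 2 ≤ z.re ∧ z.re ≤ σ₀} ⊆ U) (hc : DifferentiableOn ℂ c (U \ {1}))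
    {σ : ℝ} (hσ₁ : 1 / 2 ≤ σ) (hσ₂ : σ ≤ σ₀) (hσ : σ ≠ 1) : Continuous fun y : ℝ => c ((σ : ℂ) + y * I) := by
  have hline : ∀ y : ℝ, (σ : ℂ) + y * I ∈ U \ {1} := fun y =>
    ⟨hUs ⟨by simpa using hσ₁, by simpa using hσ₂⟩, fun h => hσ (by simpa using congrArg Complex.re h)⟩
  have hco : ContinuousOn c (U \ {1}) := hc.continuousOn
  exact hco.comp_continuous (continuous_const.add (continuous_ofReal.mul continuous_const)) hline

end Scalar

/-! ## §3 The integrand `F(z) = f̃(z)·(conj f̃′(1−z̄) + a·c(z)·conj f̃′(z̄))`: holomorphy off `z = 1`, residue, uniform `O(y⁻²)`, integrability on vertical lines -/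

section Integrand

variable {f f' : ℝ → ℂ} {c : ℂ → ℂ} {U : Set ℂ} {σ₀ B : ℝ} {a : ℝ} {r : ℂ}

/-- `F` is complex-differentiable on `U ∖ {1}` (★ A + Schwarz reflection for the Mellin factors, the letter for `c`). [cite: MoeglinWaldspurger1995, II.2.2] -/
theorem differentiableOn_innerProductIntegrand (hf : ContDiff ℝ 2 f) (hfs : HasCompactSupport f) (hf0 : tsupport f ⊆ Ioi 0)
    (hf' : ContDiff ℝ 2 f') (hf's : HasCompactSupport f') (hf'0 : tsupport f' ⊆ Ioi 0) (hc : DifferentiableOn ℂ c (U \ {1})) (a : ℝ) :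
    DifferentiableOn ℂ (fun z : ℂ => mellin f (-z) * (conj (mellin f' (-(1 - conj z))) + (a : ℂ) * c z * conj (mellin f' (-conj z)))) (U \ {1}) := by
  obtain ⟨h2, h3⟩ := differentiable_conj_mellin_reflect hf'.continuous hf's hf'0
  have h1 : Differentiable ℂ fun z : ℂ => mellin f (-z) := (differentiable_mellin hf.continuous hfs hf0).comp differentiable_neg
  exact h1.differentiableOn.mul (h2.differentiableOn.add (((differentiableOn_const _).mul hc).mul h3.differentiableOn))

/-- **THE RESIDUE AT `z = 1`**: `(z−1)·F(z) → ρ := a·r·f̃(1)·conj f̃′(1)` as `z → 1`, `z ≠ 1` (`(z−1)c(z) → r`, the Mellin factors continuous at `1`; `f̃(1) = mellin f (−1)`).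
[cite: MoeglinWaldspurger1995, II.2.4] -/
theorem tendsto_sub_one_mul_innerProductIntegrand (hf : ContDiff ℝ 2 f) (hfs : HasCompactSupport f) (hf0 : tsupport f ⊆ Ioi 0)
    (hf' : ContDiff ℝ 2 f') (hf's : HasCompactSupport f') (hf'0 : tsupport f' ⊆ Ioi 0) (hr : Tendsto (fun z : ℂ => (z - 1) * c z) (𝓝[≠] 1) (𝓝 r)) (a : ℝ) :
    Tendsto (fun z : ℂ => (z - 1) * (mellin f (-z) * (conj (mellin f' (-(1 - conj z))) + (a : ℂ) * c z * conj (mellin f' (-conj z)))))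
      (𝓝[≠] 1) (𝓝 ((a : ℂ) * r * (mellin f (-1) * conj (mellin f' (-1))))) := by
  obtain ⟨h2, h3⟩ := differentiable_conj_mellin_reflect hf'.continuous hf's hf'0
  have h1 : Differentiable ℂ fun z : ℂ => mellin f (-z) := (differentiable_mellin hf.continuous hfs hf0).comp differentiable_neg
  have e : ∀ z : ℂ, (z - 1) * (mellin f (-z) * (conj (mellin f' (-(1 - conj z))) + (a : ℂ) * c z * conj (mellin f' (-conj z)))) =
      mellin f (-z) * ((z - 1) * conj (mellin f' (-(1 - conj z))) + (a : ℂ) * ((z - 1) * c z) * conj (mellin f' (-conj z))) := fun z => by ring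
  simp_rw [e]
  have hM1 : Tendsto (fun z : ℂ => mellin f (-z)) (𝓝[≠] 1) (𝓝 (mellin f (-1))) := tendsto_nhdsWithin_of_tendsto_nhds (h1 1).continuousAt.tendsto
  have hM2 : Tendsto (fun z : ℂ => (z - 1) * conj (mellin f' (-(1 - conj z)))) (𝓝[≠] 1) (𝓝 ((1 - 1) * conj (mellin f' (-(1 - conj 1))))) :=
    tendsto_nhdsWithin_of_tendsto_nhds (((continuous_id.sub continuous_const).mul (h2.continuous)).tendsto 1)
  have hM3 : Tendsto (fun z : ℂ => conj (mellin f' (-conj z))) (𝓝[≠] 1) (𝓝 (conj (mellin f' (-conj 1)))) := tendsto_nhdsWithin_of_tendsto_nhds ((h3 1).continuousAt.tendsto)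
  have h := hM1.mul (hM2.add ((hr.const_mul (a : ℂ)).mul hM3))
  simp only [sub_self, zero_mul, zero_add, map_one] at h
  refine h.congr' (Eventually.of_forall fun z => rfl) |>.trans ?_
  rw [show (a : ℂ) * r * (mellin f (-1) * conj (mellin f' (-1))) = mellin f (-1) * ((a : ℂ) * r * conj (mellin f' (-1))) by ring]

/-- **UNIFORM `O(y⁻²)` OF THE INTEGRAND ON THE CLOSED STRIP**: `∃ K, ‖F(x+iy)‖ ≤ K∕y²` for `x ∈ [½, σ₀]`, `|y| ≥ 1` — `f̃` is `O(y⁻²)` uniformly (§1), the conjugated Mellin factors are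
bounded (§1), `‖c‖ ≤ B` there (§2 closure of the T1 letter). [cite: MoeglinWaldspurger1995, II.2.2] -/
theorem exists_norm_innerProductIntegrand_le_div_sq (hf : ContDiff ℝ 2 f) (hfs : HasCompactSupport f) (hf0 : tsupport f ⊆ Ioi 0)
    (hf' : ContDiff ℝ 2 f') (hf's : HasCompactSupport f') (hf'0 : tsupport f' ⊆ Ioi 0) (hσ₀ : 1 < σ₀)
    (hUo : IsOpen U) (hUs : {z : ℂ | 1 / 2 ≤ z.re ∧ z.re ≤ σ₀} ⊆ U) (hc : DifferentiableOn ℂ c (U \ {1}))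
    (hB : ∀ z : ℂ, 1 / 2 < z.re → z.re ≤ σ₀ → 1 ≤ |z.im| → ‖c z‖ ≤ B) (a : ℝ) :
    ∃ K : ℝ, ∀ x ∈ Icc (1 / 2 : ℝ) σ₀, ∀ y : ℝ, 1 ≤ |y| →
      ‖mellin f (-((x : ℂ) + y * I)) * (conj (mellin f' (-(1 - conj ((x : ℂ) + y * I)))) + (a : ℂ) * c ((x : ℂ) + y * I) * conj (mellin f' (-conj ((x : ℂ) + y * I))))‖ ≤ K / y ^ 2 := by
  obtain ⟨B₁, hB₁0, hB₁⟩ := exists_norm_mellin_vertical_le_div_sq_of_mem_Icc hf hfs hf0 (-σ₀) (-(1 / 2 : ℝ))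
  obtain ⟨B₂, hB₂0, hB₂⟩ := exists_norm_mellin_le_of_re_mem_Icc hf'.continuous hf's hf'0 ((1 / 2 : ℝ) - 1) (σ₀ - 1)
  obtain ⟨B₃, hB₃0, hB₃⟩ := exists_norm_mellin_le_of_re_mem_Icc hf'.continuous hf's hf'0 (-σ₀) (-(1 / 2 : ℝ))
  have hBc := norm_le_of_re_mem_Icc hUo hUs hc hσ₀ hB
  have hB0 : 0 ≤ B := (norm_nonneg _).trans (hB ((σ₀ : ℂ) + (1 : ℝ) * I) (by simp; linarith) (by simp) (by simp))
  refine ⟨B₁ * (B₂ + |a| * B * B₃), fun x hx y hy => ?_⟩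
  have hy0 : y ≠ 0 := fun h => by rw [h, abs_zero] at hy; linarith
  have hy2 : 0 < y ^ 2 := by positivity
  -- the three Mellin factors and the scalar
  have e1 : -((x : ℂ) + y * I) = ((-x : ℝ) : ℂ) + ((-y : ℝ) : ℂ) * I := by push_cast; ring
  have h1 : ‖mellin f (-((x : ℂ) + y * I))‖ ≤ B₁ / y ^ 2 := by
    rw [e1]
    have h := hB₁ (-x) ⟨by linarith [hx.2], by linarith [hx.1]⟩ (-y) (neg_ne_zero.2 hy0)
    rwa [neg_sq] at h
  have h2 : ‖conj (mellin f' (-(1 - conj ((x : ℂ) + y * I))))‖ ≤ B₂ := by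
    rw [RCLike.norm_conj]
    refine hB₂ _ ?_ ?_ <;> simp <;> linarith [hx.1, hx.2]
  have h3 : ‖conj (mellin f' (-conj ((x : ℂ) + y * I)))‖ ≤ B₃ := by
    rw [RCLike.norm_conj]
    refine hB₃ _ ?_ ?_ <;> simp <;> linarith [hx.1, hx.2]
  have h4 : ‖c ((x : ℂ) + y * I)‖ ≤ B := hBc _ (by simpa using hx.1) (by simpa using hx.2) (by simpa using hy)
  calc ‖mellin f (-((x : ℂ) + y * I)) * (conj (mellin f' (-(1 - conj ((x : ℂ) + y * I)))) + (a : ℂ) * c ((x : ℂ) + y * I) * conj (mellin f' (-conj ((x : ℂ) + y * I))))‖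
      ≤ ‖mellin f (-((x : ℂ) + y * I))‖ * (‖conj (mellin f' (-(1 - conj ((x : ℂ) + y * I))))‖ + ‖(a : ℂ)‖ * ‖c ((x : ℂ) + y * I)‖ * ‖conj (mellin f' (-conj ((x : ℂ) + y * I)))‖) := by
        rw [norm_mul]
        refine mul_le_mul_of_nonneg_left ((norm_add_le _ _).trans (add_le_add le_rfl ?_)) (norm_nonneg _)
        rw [norm_mul, norm_mul]
    _ ≤ (B₁ / y ^ 2) * (B₂ + |a| * B * B₃) := by
        refine mul_le_mul h1 (add_le_add h2 ?_) (by positivity) (by positivity)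
        rw [Complex.norm_real, Real.norm_eq_abs]
        exact mul_le_mul (mul_le_mul_of_nonneg_left h4 (abs_nonneg a)) h3 (norm_nonneg _) (by positivity)
    _ = B₁ * (B₂ + |a| * B * B₃) / y ^ 2 := by ring

/-- **`y ↦ F(σ+iy)` IS INTEGRABLE for every `σ ∈ [½, σ₀]`, `σ ≠ 1`** — continuous (§2) and `O(y⁻²)` (the previous theorem): «`F ∈ L¹` explicit» of ROADCARD T4, in particular on the
unitary axis `σ = ½` and on `σ = σ₀`. [cite: MoeglinWaldspurger1995, II.2.2] -/
theorem integrable_innerProductIntegrand_vertical (hf : ContDiff ℝ 2 f) (hfs : HasCompactSupport f) (hf0 : tsupport f ⊆ Ioi 0)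
    (hf' : ContDiff ℝ 2 f') (hf's : HasCompactSupport f') (hf'0 : tsupport f' ⊆ Ioi 0) (hσ₀ : 1 < σ₀)
    (hUo : IsOpen U) (hUs : {z : ℂ | 1 / 2 ≤ z.re ∧ z.re ≤ σ₀} ⊆ U) (hc : DifferentiableOn ℂ c (U \ {1}))
    (hB : ∀ z : ℂ, 1 / 2 < z.re → z.re ≤ σ₀ → 1 ≤ |z.im| → ‖c z‖ ≤ B) (a : ℝ) {σ : ℝ} (hσ₁ : 1 / 2 ≤ σ) (hσ₂ : σ ≤ σ₀) (hσ : σ ≠ 1) :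
    Integrable fun y : ℝ => mellin f (-((σ : ℂ) + y * I)) * (conj (mellin f' (-(1 - conj ((σ : ℂ) + y * I)))) + (a : ℂ) * c ((σ : ℂ) + y * I) * conj (mellin f' (-conj ((σ : ℂ) + y * I)))) := by
  obtain ⟨K, hK⟩ := exists_norm_innerProductIntegrand_le_div_sq hf hfs hf0 hf' hf's hf'0 hσ₀ hUo hUs hc hB a
  obtain ⟨h2, h3⟩ := differentiable_conj_mellin_reflect hf'.continuous hf's hf'0
  have h1 : Differentiable ℂ fun z : ℂ => mellin f (-z) := (differentiable_mellin hf.continuous hfs hf0).comp differentiable_neg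
  have hL : Continuous fun y : ℝ => (σ : ℂ) + y * I := continuous_const.add (continuous_ofReal.mul continuous_const)
  refine integrable_of_continuous_of_sq_decay ?_ (hK σ ⟨hσ₁, hσ₂⟩)
  exact (h1.continuous.comp hL).mul ((h2.continuous.comp hL).add ((continuous_const.mul (continuous_scalar_vertical hUs hc hσ₁ hσ₂ hσ)).mul (h3.continuous.comp hL)))

/-- **THE CONTOUR SHIFT OF THE INNER-PRODUCT INTEGRAND** (★ T4a `integral_vertical_eq_integral_vertical_add_residue` at `σ₁ = ½`, `σ₂ = σ₀`):
`∫_ℝ F(σ₀+iy) dy = ∫_ℝ F(½+iy) dy + 2π·(a·r·f̃(1)·conj f̃′(1))`. [cite: MoeglinWaldspurger1995, II.2.4] [cite: Titchmarsh1939, §3.12] -/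
theorem integral_innerProductIntegrand_eq_add_residue (hf : ContDiff ℝ 2 f) (hfs : HasCompactSupport f) (hf0 : tsupport f ⊆ Ioi 0)
    (hf' : ContDiff ℝ 2 f') (hf's : HasCompactSupport f') (hf'0 : tsupport f' ⊆ Ioi 0) (hσ₀ : 1 < σ₀)
    (hUo : IsOpen U) (hUs : {z : ℂ | 1 / 2 ≤ z.re ∧ z.re ≤ σ₀} ⊆ U) (hc : DifferentiableOn ℂ c (U \ {1})) (hr : Tendsto (fun z : ℂ => (z - 1) * c z) (𝓝[≠] 1) (𝓝 r))
    (hB : ∀ z : ℂ, 1 / 2 < z.re → z.re ≤ σ₀ → 1 ≤ |z.im| → ‖c z‖ ≤ B) (a : ℝ) :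
    ∫ y : ℝ, mellin f (-((σ₀ : ℂ) + y * I)) * (conj (mellin f' (-(1 - conj ((σ₀ : ℂ) + y * I)))) + (a : ℂ) * c ((σ₀ : ℂ) + y * I) * conj (mellin f' (-conj ((σ₀ : ℂ) + y * I)))) =
      (∫ y : ℝ, mellin f (-((((1 / 2 : ℝ)) : ℂ) + y * I)) *
          (conj (mellin f' (-(1 - conj ((((1 / 2 : ℝ)) : ℂ) + y * I)))) + (a : ℂ) * c ((((1 / 2 : ℝ)) : ℂ) + y * I) * conj (mellin f' (-conj ((((1 / 2 : ℝ)) : ℂ) + y * I))))) +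
        2 * π * ((a : ℂ) * r * (mellin f (-1) * conj (mellin f' (-1)))) := by
  obtain ⟨K, hK⟩ := exists_norm_innerProductIntegrand_le_div_sq hf hfs hf0 hf' hf's hf'0 hσ₀ hUo hUs hc hB a
  exact integral_vertical_eq_integral_vertical_add_residue (F := fun z : ℂ => mellin f (-z) * (conj (mellin f' (-(1 - conj z))) + (a : ℂ) * c z * conj (mellin f' (-conj z))))
    (by norm_num) (by norm_num) hσ₀ hUo hUs (differentiableOn_innerProductIntegrand hf hfs hf0 hf' hf's hf'0 hc a)
    (tendsto_sub_one_mul_innerProductIntegrand hf hfs hf0 hf' hf's hf'0 hr a)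
    (integrable_innerProductIntegrand_vertical hf hfs hf0 hf' hf's hf'0 hσ₀ hUo hUs hc hB a (le_refl _) (by linarith) (by norm_num))
    (integrable_innerProductIntegrand_vertical hf hfs hf0 hf' hf's hf'0 hσ₀ hUo hUs hc hB a (by linarith) le_rfl hσ₀.ne') hK

end Integrand

/-! ## §4 HEAD: the inner product formula moved to the unitary axis -/

/-- **HEAD — THE INNER PRODUCT FORMULA FOR SPHERICAL PSEUDO-EISENSTEIN SERIES ON THE UNITARY AXIS (ROADCARD T4), ON LETTERS.**  Data: `f, f′ ∈ C²_c((0,∞))`, `σ₀ > 1`, a real scalar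
`a` (`= (ν𝓕)⁻¹` in ★ FILE D), the scalar `c` with LETTERS `hc` (holomorphic on an open `U ⊇ {½ ≤ Re z ≤ σ₀}` off `z = 1`), `hr` (`(z−1)c(z) → r`), `hB` (T1 ★ p859417 bytes:
`‖c z‖ ≤ B` on `½ < Re z ≤ σ₀, |Im z| ≥ 1`), and the inner-product identity `hIP : IP = C·((2π)⁻¹·∫_ℝ F(σ₀+iy) dy)` (★ FILE D `pseudoEisenstein_inner_product_cm_two[_of_letters]`, whose
integrand `F(z) = f̃(z)·(conj f̃′(1−z̄) + a·c(z)·conj f̃′(z̄))` is spelled below verbatim; K2E3-p12's Final writes `conj (mellin f′ (conj z − 1))` for the same first factor).  CONCLUSION: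
**`IP = C·(a·r·f̃(1)·conj f̃′(1)) + C·((2π)⁻¹·∫_ℝ F(½+iy) dy)`** — the residual (constant-function) term plus the unitary-axis integral, with `y ↦ F(½+iy) ∈ L¹`
(`integrable_innerProductIntegrand_vertical`). [cite: MoeglinWaldspurger1995, II.2.1, II.2.4] [cite: Titchmarsh1939, §3.12] -/
theorem pseudoEisenstein_contourShift_of_letters {f f' : ℝ → ℂ} (hf : ContDiff ℝ 2 f) (hfs : HasCompactSupport f) (hf0 : tsupport f ⊆ Ioi 0)
    (hf' : ContDiff ℝ 2 f') (hf's : HasCompactSupport f') (hf'0 : tsupport f' ⊆ Ioi 0) {σ₀ : ℝ} (hσ₀ : 1 < σ₀) (a : ℝ)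
    {c : ℂ → ℂ} {U : Set ℂ} (hUo : IsOpen U) (hUs : {z : ℂ | 1 / 2 ≤ z.re ∧ z.re ≤ σ₀} ⊆ U) (hc : DifferentiableOn ℂ c (U \ {1}))
    {r : ℂ} (hr : Tendsto (fun z : ℂ => (z - 1) * c z) (𝓝[≠] 1) (𝓝 r)) {B : ℝ} (hB : ∀ z : ℂ, 1 / 2 < z.re → z.re ≤ σ₀ → 1 ≤ |z.im| → ‖c z‖ ≤ B)
    {IP C : ℂ} (hIP : IP = C * ((((2 * π)⁻¹ : ℝ) : ℂ) * ∫ y : ℝ, mellin f (-((σ₀ : ℂ) + y * I)) *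
      (conj (mellin f' (-(1 - conj ((σ₀ : ℂ) + y * I)))) + (a : ℂ) * c ((σ₀ : ℂ) + y * I) * conj (mellin f' (-conj ((σ₀ : ℂ) + y * I)))))) :
    IP = C * ((a : ℂ) * r * (mellin f (-1) * conj (mellin f' (-1)))) +
      C * ((((2 * π)⁻¹ : ℝ) : ℂ) * ∫ y : ℝ, mellin f (-((((1 / 2 : ℝ)) : ℂ) + y * I)) *
        (conj (mellin f' (-(1 - conj ((((1 / 2 : ℝ)) : ℂ) + y * I)))) + (a : ℂ) * c ((((1 / 2 : ℝ)) : ℂ) + y * I) * conj (mellin f' (-conj ((((1 / 2 : ℝ)) : ℂ) + y * I))))) := by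
  rw [hIP, integral_innerProductIntegrand_eq_add_residue hf hfs hf0 hf' hf's hf'0 hσ₀ hUo hUs hc hr hB a]
  have hπ : ((((2 * π)⁻¹ : ℝ) : ℂ)) * (2 * π) = 1 := by
    push_cast
    exact inv_mul_cancel₀ (mul_ne_zero two_ne_zero (ofReal_ne_zero.2 Real.pi_pos.ne'))
  calc C * ((((2 * π)⁻¹ : ℝ) : ℂ) * ((∫ y : ℝ, mellin f (-((((1 / 2 : ℝ)) : ℂ) + y * I)) *
          (conj (mellin f' (-(1 - conj ((((1 / 2 : ℝ)) : ℂ) + y * I)))) + (a : ℂ) * c ((((1 / 2 : ℝ)) : ℂ) + y * I) * conj (mellin f' (-conj ((((1 / 2 : ℝ)) : ℂ) + y * I))))) +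
          2 * π * ((a : ℂ) * r * (mellin f (-1) * conj (mellin f' (-1))))))
      = C * (((((2 * π)⁻¹ : ℝ) : ℂ)) * (2 * π)) * ((a : ℂ) * r * (mellin f (-1) * conj (mellin f' (-1)))) +
          C * ((((2 * π)⁻¹ : ℝ) : ℂ) * ∫ y : ℝ, mellin f (-((((1 / 2 : ℝ)) : ℂ) + y * I)) *
            (conj (mellin f' (-(1 - conj ((((1 / 2 : ℝ)) : ℂ) + y * I)))) + (a : ℂ) * c ((((1 / 2 : ℝ)) : ℂ) + y * I) * conj (mellin f' (-conj ((((1 / 2 : ℝ)) : ℂ) + y * I))))) := by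
        ring
    _ = _ := by rw [hπ, mul_one]

end Summit.HodgeConjecture.HodgeConjecture.Cruxes.H413.K2E1PseudoEisensteinContourShiftCMTwo

end
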